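import Mathlib
import Summits.ResolutionOfSingularities.ResolutionOfSingularities.Theorems.HomologicalConductorPersistenceSurfaceSaturationHypersurfaceSectionExt
import Literature.RingTheory.Depth.CohenMacaulayGradeHeight
import Literature.AlgebraicGeometry.Resolution.SecantSequenceLifts
import HarnessLib

/-!
# Rung S-2 `PersistenceSurface` (stmt-ResolutionOfSingularities-19970) — the Gorenstein input at
# COMPLETE-INTERSECTION stages of ANY codimension: `Extⁱ_{S/(x₁,…,x_c)}(·, S/(x₁,…,x_c)) = 0` for `i ≥ dim + 1`

Route `ResolutionOfSingularities/HomologicalConductor`, chain W4.4b, rung S-2 `PersistenceSurface`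
(stmt-ResolutionOfSingularities-19970), registered skeleton 1a77c002, stub
`stub_saturationFourSurfaceResidualFour : SaturationFourSurfaceResidual₄`.  [OURS · pure homological algebra;
AI-written, weaker than expert review; NOT a statement of the manuscript under study (Hironaka 2017) and no statement
of that manuscript is used.]  DEF-FREE; `--supports` only.

Hand leafhand-res-homologicalconduct-2 discharged the Gorenstein input `hGor` of
`…PersistenceSurfaceSaturationGorenstein` (`∀ W f.g., ∀ i ≥ 3, Extⁱ_T(W, T) = 0 ⇒ ca(T) = ca³(T)`, p794975) at
complete intersections of codimension ONE and TWO (`…SaturationHypersurfaceSectionExt`, p796846/p796904) and left the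
general codimension as item (CIc) of its census.  This file closes (CIc): the vanishing half of Rees' change-of-rings
lemma [Bruns–Herzog, Lemma 3.1.16] is iterated along a WEAKLY REGULAR SEQUENCE of any length (Mathlib
`RingTheory.Sequence.IsWeaklyRegular`), the intermediate rings being re-presented through
`DoubleQuot.quotQuotEquivQuotSup` and the transport lemma `ext_eq_zero_of_ringEquiv` (p796996):

* `isWeaklyRegular_quotient_of_cons` — bridge: `r :: rs` weakly regular on `S` ⇒ `r` is a non-zero-divisor and the
  images of `rs` are weakly regular on the RING `S ⧸ (r)`;
* **`ext_quotient_ofList_eq_zero_of_ext_eq_zero`** — `S` noetherian, `rs` weakly regular of length `c`, `n ≥ 1`: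
  `Extʲ_S(W', S) = 0 (j ≥ n + c)` for all finitely generated `W'` ⇒ `Extⁱ_{S/(rs)}(W, S/(rs)) = 0 (i ≥ n)` for all
  finitely generated `W` — the self-injective dimension drops by the length of the sequence;
* `ext_ofList_eq_zero_of_isRegularLocalRing` — `S` regular local of dimension `d + c` ⇒ the vanishing at level
  `d + 1` over `S ⧸ (rs)`;
* `cohomologyAnnihilator_eq_three_ofList` — `Sat₃`: `ca = ca³` for every complete-intersection surface ring
  `S ⧸ (x₁, …, x_c)`, `S` regular local of dimension `2 + c`, that is a domain;
* `ca_subset_caAt_of_ringEquiv_ofList` — route vocabulary: a stage `↥T` PRESENTED as such a ring has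
  `ca T ⊆ caAt n T` for every `n ≥ 3`, in particular the `m`-th conjunct `ca ⊆ caAt 4` of
  `SaturationFourSurfaceResidual₄` there (the presentation is the consumer's input).

Net effect on the by-name chain: the (NG) hypothesis of the door of record
(`…PersistenceSurfaceDoorNonGorenstein`) is certified at every stage presented as a complete intersection in a
regular local ring, whatever the embedding codimension — not only `≤ 2`.

References: W. Bruns, J. Herzog, *Cohen–Macaulay rings*, rev. ed. 1998, Lemma 3.1.16, Prop. 3.1.19, Thm. 3.3.10
[`BrunsHerzog1998`]; S. B. Iyengar, R. Takahashi, IMRN 2016, §2 [`IyengarTakahashi2014`] (mechanism only).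
-/

noncomputable section

-- single-problem summit: the doubled namespace component `ResolutionOfSingularities` is forced
set_option linter.dupNamespace false

namespace Summit.ResolutionOfSingularities.ResolutionOfSingularities.Theorems.HomologicalConductor.PersistenceSurfaceSaturationRegularSequenceExt

open CategoryTheory CategoryTheory.Abelian Literature.RingTheory.CohomologyAnnihilator RingTheory.Sequence
open Summit.ResolutionOfSingularities.ResolutionOfSingularities.Theorems.HomologicalConductor.PersistenceSurfaceSaturationHypersurfaceSectionExt
open Summit.ResolutionOfSingularities.ResolutionOfSingularities.Theorems.HomologicalConductor.PersistenceSurfaceSaturationGorenstein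

universe u

open scoped Pointwise

/-! ## Bridge: regular sequences pass to the quotient ring -/

section Bridge

variable {S : Type u} [CommRing S]

/-- **Bridge.** If `r :: rs` is a weakly regular sequence on `S` (as a module over itself), then `r` is a
non-zero-divisor of `S` and the images of `rs` in the RING `S ⧸ (r)` form a weakly regular sequence on `S ⧸ (r)` as
a module over itself (Mathlib's `isWeaklyRegular_cons_iff` phrases the tail on the `S`-module `S ⧸ r • ⊤`; the two
quotients agree since `r • ⊤ = (r)`). [cite: BrunsHerzog1998, Lemma 3.1.16] -/
theorem isWeaklyRegular_quotient_of_cons {r : S} {rs : List S} (h : IsWeaklyRegular S (r :: rs)) :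
    IsSMulRegular S r ∧
      IsWeaklyRegular (S ⧸ Ideal.span ({r} : Set S))
        (rs.map (Ideal.Quotient.mk (Ideal.span ({r} : Set S)))) := by
  rw [isWeaklyRegular_cons_iff] at h
  refine ⟨h.1, ?_⟩
  have hsub : r • (⊤ : Submodule S S) = (Ideal.span ({r} : Set S) : Submodule S S) := by
    rw [← Submodule.ideal_span_singleton_smul, Ideal.smul_eq_mul, Ideal.mul_top]
  have h2 : IsWeaklyRegular (S ⧸ Ideal.span ({r} : Set S)) rs :=
    ((Submodule.quotEquivOfEq _ _ hsub).isWeaklyRegular_congr rs).mp h.2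
  have h3 := (isWeaklyRegular_map_algebraMap_iff (S ⧸ Ideal.span ({r} : Set S))
    (S ⧸ Ideal.span ({r} : Set S)) rs).mpr h2
  rwa [Ideal.Quotient.algebraMap_eq] at h3

end Bridge

/-! ## Change of rings along a weakly regular sequence -/

section ChangeOfRings

/-- **CHANGE OF RINGS along a weakly regular sequence (vanishing half of Rees' lemma, iterated)** — the induction
on the length `c`, uniform in the (noetherian) ring: if `rs` is weakly regular on `S` of length `c`, `n ≥ 1`, and
`Extʲ_S(W', S) = 0` for every finitely generated `S`-module `W'` and every `j ≥ n + c`, then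
`Extⁱ_{S/(rs)}(W, S/(rs)) = 0` for every finitely generated `S/(rs)`-module `W` and every `i ≥ n`.
Step: `ext_quotient_eq_zero_of_ext_eq_zero` (one non-zero-divisor, p796846) on `S`, the induction hypothesis on
`S ⧸ (r)`, and transport along the re-presentation `S ⧸ (r, rs') ≃+* (S ⧸ (r)) ⧸ (rs' mod r)`
(`Ideal.ofList_cons`, `DoubleQuot.quotQuotEquivQuotSup`, `Ideal.map_ofList`; `ext_eq_zero_of_ringEquiv`, p796996).
[cite: BrunsHerzog1998, Lemma 3.1.16] -/
theorem ext_quotient_ofList_eq_zero_aux (n c : ℕ) (hn : 1 ≤ n) :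
    ∀ (S : Type u) [CommRing S] [IsNoetherianRing S] (rs : List S), rs.length = c →
      IsWeaklyRegular S rs →
      (∀ (W' : ModuleCat.{u} S), Module.Finite S W' → ∀ j : ℕ, n + c ≤ j →
        ∀ e : Ext.{u} W' (ModuleCat.of S S) j, e = 0) →
      ∀ (W : ModuleCat.{u} (S ⧸ Ideal.ofList rs)), Module.Finite (S ⧸ Ideal.ofList rs) W →
        ∀ i : ℕ, n ≤ i →
          ∀ e : Ext.{u} W (ModuleCat.of (S ⧸ Ideal.ofList rs) (S ⧸ Ideal.ofList rs)) i, e = 0 := by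
  induction c with
  | zero =>
    intro S _ _ rs hlen hreg hS W hW i hi e
    cases rs with
    | cons _ _ => simp at hlen
    | nil =>
      let φ : (S ⧸ Ideal.ofList ([] : List S)) ≃+* S :=
        (Ideal.quotEquivOfEq (Ideal.ofList_nil)).trans (RingEquiv.quotientBot S)
      exact ext_eq_zero_of_ringEquiv φ (n := n)
        (fun W' hW' j hj x => hS W' hW' j (by omega) x) W hW hi e
  | succ c ih =>
    intro S _ _ rs hlen hreg hS W hW i hi e
    obtain ⟨r, rs', rfl⟩ := List.exists_of_length_succ rs hlen
    have hlen' : rs'.length = c := by simpa using hlen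
    obtain ⟨hr, hreg'⟩ := isWeaklyRegular_quotient_of_cons hreg
    have hS₁ : ∀ (W' : ModuleCat.{u} (S ⧸ Ideal.span ({r} : Set S))),
        Module.Finite (S ⧸ Ideal.span ({r} : Set S)) W' → ∀ j : ℕ, n + c ≤ j →
          ∀ e' : Ext.{u} W' (ModuleCat.of (S ⧸ Ideal.span ({r} : Set S))
            (S ⧸ Ideal.span ({r} : Set S))) j, e' = 0 :=
      fun W' hW' j hj e' => ext_quotient_eq_zero_of_ext_eq_zero hr (n := n + c) (by omega)
        (fun W'' hW'' j' hj' e'' => hS W'' hW'' j' (by omega) e'') W' hW' hj e'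
    have hrec := ih (S ⧸ Ideal.span ({r} : Set S))
      (rs'.map (Ideal.Quotient.mk (Ideal.span ({r} : Set S)))) (by simp [hlen']) hreg' hS₁
    -- re-presentation `S ⧸ (r, rs') ≃+* (S ⧸ (r)) ⧸ (rs' mod r)` (a local term, keeping the file def-free)
    let φ : (S ⧸ Ideal.ofList (r :: rs')) ≃+*
        ((S ⧸ Ideal.span ({r} : Set S)) ⧸
          Ideal.ofList (rs'.map (Ideal.Quotient.mk (Ideal.span ({r} : Set S))))) :=
      ((Ideal.quotEquivOfEq (Ideal.ofList_cons r rs')).trans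
        (DoubleQuot.quotQuotEquivQuotSup (Ideal.span ({r} : Set S)) (Ideal.ofList rs')).symm).trans
        (Ideal.quotEquivOfEq (Ideal.map_ofList (Ideal.Quotient.mk (Ideal.span ({r} : Set S))) rs'))
    exact ext_eq_zero_of_ringEquiv φ (n := n) hrec W hW hi e

variable {S : Type u} [CommRing S]

/-- **CHANGE OF RINGS along a weakly regular sequence** (packaged form of `ext_quotient_ofList_eq_zero_aux`):
`S` noetherian, `rs` weakly regular on `S`, `n ≥ 1`, `Extʲ_S(W', S) = 0` for all finitely generated `W'` and all
`j ≥ n + rs.length` ⇒ `Extⁱ_{S/(rs)}(W, S/(rs)) = 0` for all finitely generated `W` and all `i ≥ n`.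
[cite: BrunsHerzog1998, Lemma 3.1.16] -/
theorem ext_quotient_ofList_eq_zero_of_ext_eq_zero [IsNoetherianRing S] (rs : List S)
    (hreg : IsWeaklyRegular S rs) {n : ℕ} (hn : 1 ≤ n)
    (hS : ∀ (W' : ModuleCat.{u} S), Module.Finite S W' → ∀ j : ℕ, n + rs.length ≤ j →
      ∀ e : Ext.{u} W' (ModuleCat.of S S) j, e = 0)
    (W : ModuleCat.{u} (S ⧸ Ideal.ofList rs)) (hW : Module.Finite (S ⧸ Ideal.ofList rs) W)
    {i : ℕ} (hi : n ≤ i)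
    (e : Ext.{u} W (ModuleCat.of (S ⧸ Ideal.ofList rs) (S ⧸ Ideal.ofList rs)) i) : e = 0 :=
  ext_quotient_ofList_eq_zero_aux n rs.length hn S rs rfl hreg hS W hW i hi e

end ChangeOfRings

/-! ## Regular base: complete intersections of any codimension -/

section CompleteIntersection

variable {S : Type u} [CommRing S]

/-- **Complete intersections of any codimension**: `S` regular local of dimension `d + rs.length`, `rs` weakly
regular on `S` ⇒ `Extⁱ(W, S ⧸ (rs)) = 0` over `S ⧸ (rs)` for all finitely generated `W` and all `i ≥ d + 1`
(base `ext_eq_zero_of_isRegularLocalRing`, p796846). [cite: BrunsHerzog1998, Lemma 3.1.16, Prop. 3.1.19] -/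
theorem ext_ofList_eq_zero_of_isRegularLocalRing [IsRegularLocalRing S] {d : ℕ} (rs : List S)
    (hd : ringKrullDim S = (d + rs.length : ℕ)) (hreg : IsWeaklyRegular S rs)
    (W : ModuleCat.{u} (S ⧸ Ideal.ofList rs)) (hW : Module.Finite (S ⧸ Ideal.ofList rs) W)
    {i : ℕ} (hi : d + 1 ≤ i)
    (e : Ext.{u} W (ModuleCat.of (S ⧸ Ideal.ofList rs) (S ⧸ Ideal.ofList rs)) i) : e = 0 :=
  ext_quotient_ofList_eq_zero_of_ext_eq_zero rs hreg (n := d + 1) (by omega)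
    (fun W' hW' j hj e' => ext_eq_zero_of_isRegularLocalRing hd W' hW' (by omega) e') W hW hi e

/-- **`Sat₃` at a complete-intersection surface ring of any codimension**: `S` regular local of dimension
`2 + rs.length`, `rs` weakly regular on `S`, `S ⧸ (rs)` a domain ⇒ `ca(S ⧸ (rs)) = ca³(S ⧸ (rs))`
(`cohomologyAnnihilator_eq_three_of_ext_eq_zero`, p794975). [cite: BrunsHerzog1998, Thm. 3.3.10; IyengarTakahashi2014, §2] -/
theorem cohomologyAnnihilator_eq_three_ofList [IsRegularLocalRing S] (rs : List S)
    (hd : ringKrullDim S = (2 + rs.length : ℕ)) (hreg : IsWeaklyRegular S rs)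
    [IsDomain (S ⧸ Ideal.ofList rs)] :
    cohomologyAnnihilator (S ⧸ Ideal.ofList rs) = cohomologyAnnihilatorOfDegree (S ⧸ Ideal.ofList rs) 3 :=
  cohomologyAnnihilator_eq_three_of_ext_eq_zero fun W hW _ hi e =>
    ext_ofList_eq_zero_of_isRegularLocalRing (d := 2) rs hd hreg W hW hi e

/-- Levelled form: `caⁿ(S ⧸ (rs)) = ca³(S ⧸ (rs))` for every `n ≥ 3` at such a complete-intersection surface ring
(`cohomologyAnnihilatorOfDegree_eq_three_of_ext_eq_zero`). [cite: IyengarTakahashi2014, §2] -/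
theorem cohomologyAnnihilatorOfDegree_eq_three_ofList [IsRegularLocalRing S] (rs : List S)
    (hd : ringKrullDim S = (2 + rs.length : ℕ)) (hreg : IsWeaklyRegular S rs)
    [IsDomain (S ⧸ Ideal.ofList rs)] {n : ℕ} (hn : 3 ≤ n) :
    cohomologyAnnihilatorOfDegree (S ⧸ Ideal.ofList rs) n =
      cohomologyAnnihilatorOfDegree (S ⧸ Ideal.ofList rs) 3 :=
  cohomologyAnnihilatorOfDegree_eq_three_of_ext_eq_zero (fun W hW _ hi e =>
    ext_ofList_eq_zero_of_isRegularLocalRing (d := 2) rs hd hreg W hW hi e) hn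

end CompleteIntersection

/-! ## Route vocabulary: `Satₙ` at a stage PRESENTED as a complete intersection of any codimension -/

section Stage

variable {k K : Type u} [Field k] [Field K] [Algebra k K]

/-- **`Satₙ` (`n ≥ 3`) at a stage presented as a complete-intersection surface ring of any codimension.**  For a
subalgebra stage `T ⊆ K` with a ring isomorphism `e : ↥T ≃+* S ⧸ (rs)`, `S` regular local of Krull dimension
`2 + rs.length` and `rs` weakly regular on `S`: the route's inline sets satisfy `ca T ⊆ caAt n T` for every `n ≥ 3` —
in particular the `m`-th conjunct `ca ⊆ caAt 4` of `SaturationFourSurfaceResidual₄` at such a stage, and the (NG)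
hypothesis of `…PersistenceSurfaceDoorNonGorenstein` is idle there (`ext_ofList_eq_zero_of_isRegularLocalRing` +
`ca_subset_caAt_of_ringEquiv_of_ext_eq_zero`, p795661; `S ⧸ (rs)` is a domain because `↥T` is).  The presentation `e`
and the regularity of `rs` are the consumer's input. [cite: BrunsHerzog1998, Lemma 3.1.16, Thm. 3.3.10; IyengarTakahashi2014, §2] -/
theorem ca_subset_caAt_of_ringEquiv_ofList (T : Subalgebra k K) {S : Type u} [CommRing S]
    [IsRegularLocalRing S] (rs : List S) (hd : ringKrullDim S = (2 + rs.length : ℕ))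
    (hreg : IsWeaklyRegular S rs) (e : ↥T ≃+* S ⧸ Ideal.ofList rs) {n : ℕ} (hn : 3 ≤ n) :
    {x : K | ∃ hx : x ∈ T, ∃ m : ℕ, ∀ i : ℕ, m ≤ i → ∀ (M N : ModuleCat.{u} ↥T),
        Module.Finite ↥T M → Module.Finite ↥T N →
          ∀ e : CategoryTheory.Abelian.Ext.{u} M N i, (⟨x, hx⟩ : ↥T) • e = 0} ⊆
      {x : K | ∃ hx : x ∈ T, ∀ i : ℕ, n ≤ i → ∀ (M N : ModuleCat.{u} ↥T),
        Module.Finite ↥T M → Module.Finite ↥T N →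
          ∀ e : CategoryTheory.Abelian.Ext.{u} M N i, (⟨x, hx⟩ : ↥T) • e = 0} := by
  haveI : IsDomain (S ⧸ Ideal.ofList rs) := MulEquiv.isDomain ↥T e.symm.toMulEquiv
  exact ca_subset_caAt_of_ringEquiv_of_ext_eq_zero T e
    (fun W hW _ hi e' => ext_ofList_eq_zero_of_isRegularLocalRing (d := 2) rs hd hreg W hW hi e') hn

end Stage

/-! ## Complete intersections recognised by the EQUATION COUNT (appended)

In a regular (hence Cohen–Macaulay) local ring `S`, `height I + dim S/I = dim S` for `I ⊆ 𝔪` [Bruns–Herzog Cor. 2.1.4 with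
Cor. 2.2.6] (tree `Literature.RingTheory.Depth.IsCohenMacaulayLocalRing.height_add_ringKrullDim_quotient_eq`), and `c`
elements of `𝔪` generating an ideal of height `≥ c` form a weakly regular sequence [Matsumura Thm. 17.4] (tree
`Literature.AlgebraicGeometry.Resolution.isWeaklyRegular_of_length_le_height`).  Hence the regularity hypothesis `hreg` of
the theorems above is discharged by a DIMENSION COUNT: `dim S = d + c` and `dim S/(f₁,…,f_c) = d`.  For a two-dimensional
stage presented as `S ⧸ (f₁,…,f_c)` with `dim S = 2 + c` nothing beyond the presentation is needed (`dim ↥T = 2` is a binder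
of `SaturationFourSurfaceResidual₄`). -/

section EquationCount

open IsLocalRing

variable {S : Type u} [CommRing S]

/-- **Equation count ⇒ regular sequence** in a regular local ring: if `rs ⊆ 𝔪`, `dim S = d + rs.length` and
`dim S ⧸ (rs) = d`, then `rs` is a weakly regular sequence on `S` (`height (rs) = rs.length` by the Cohen–Macaulay
dimension formula, then Matsumura 17.4). [cite: BrunsHerzog1998, Cor. 2.1.4; Matsumura1987, Thm. 17.4 (iii)] -/
theorem isWeaklyRegular_of_ringKrullDim_quotient_eq [IsRegularLocalRing S] (rs : List S)
    (hmem : ∀ x ∈ rs, x ∈ maximalIdeal S) {d : ℕ} (hd : ringKrullDim S = (d + rs.length : ℕ))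
    (hq : ringKrullDim (S ⧸ Ideal.ofList rs) = (d : ℕ)) : IsWeaklyRegular S rs := by
  have hle : Ideal.ofList rs ≤ maximalIdeal S := Ideal.span_le.mpr fun x hx => hmem x hx
  have hne : Ideal.ofList rs ≠ ⊤ := fun h => (maximalIdeal.isMaximal S).ne_top (top_le_iff.mp (h ▸ hle))
  have hh := (Literature.RingTheory.Depth.isCohenMacaulayLocalRing_of_isRegularLocalRing S)
    |>.height_add_ringKrullDim_quotient_eq hle
  obtain ⟨e, he⟩ := ENat.ne_top_iff_exists.mp ((Ideal.ofList rs).height_ne_top hne)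
  rw [hd, hq, ← he] at hh
  have h1 : e + d = d + rs.length := by exact_mod_cast hh
  have h2 : e = rs.length := by omega
  refine Literature.AlgebraicGeometry.Resolution.isWeaklyRegular_of_length_le_height hmem ?_
  rw [← he, h2]

/-- **Complete intersections by equation count**: `S` regular local of dimension `d + rs.length`, `rs ⊆ 𝔪`,
`dim S ⧸ (rs) = d` ⇒ `Extⁱ(W, S ⧸ (rs)) = 0` over `S ⧸ (rs)` for all finitely generated `W` and all `i ≥ d + 1`.
[cite: BrunsHerzog1998, Lemma 3.1.16, Cor. 2.1.4] -/
theorem ext_ofList_eq_zero_of_ringKrullDim_quotient_eq [IsRegularLocalRing S] {d : ℕ} (rs : List S)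
    (hmem : ∀ x ∈ rs, x ∈ maximalIdeal S) (hd : ringKrullDim S = (d + rs.length : ℕ))
    (hq : ringKrullDim (S ⧸ Ideal.ofList rs) = (d : ℕ))
    (W : ModuleCat.{u} (S ⧸ Ideal.ofList rs)) (hW : Module.Finite (S ⧸ Ideal.ofList rs) W)
    {i : ℕ} (hi : d + 1 ≤ i)
    (e : Ext.{u} W (ModuleCat.of (S ⧸ Ideal.ofList rs) (S ⧸ Ideal.ofList rs)) i) : e = 0 :=
  ext_ofList_eq_zero_of_isRegularLocalRing rs hd (isWeaklyRegular_of_ringKrullDim_quotient_eq rs hmem hd hq)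
    W hW hi e

/-- **`Sat₃` at a complete-intersection surface ring recognised by equation count**: `S` regular local of dimension
`2 + rs.length`, `rs ⊆ 𝔪`, `S ⧸ (rs)` a domain of Krull dimension `2` ⇒ `ca(S ⧸ (rs)) = ca³(S ⧸ (rs))`.
[cite: BrunsHerzog1998, Thm. 3.3.10, Cor. 2.1.4; IyengarTakahashi2014, §2] -/
theorem cohomologyAnnihilator_eq_three_ofList_of_ringKrullDim [IsRegularLocalRing S] (rs : List S)
    (hmem : ∀ x ∈ rs, x ∈ maximalIdeal S) (hd : ringKrullDim S = (2 + rs.length : ℕ))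
    (hq : ringKrullDim (S ⧸ Ideal.ofList rs) = (2 : ℕ)) [IsDomain (S ⧸ Ideal.ofList rs)] :
    cohomologyAnnihilator (S ⧸ Ideal.ofList rs) = cohomologyAnnihilatorOfDegree (S ⧸ Ideal.ofList rs) 3 :=
  cohomologyAnnihilator_eq_three_ofList rs hd (isWeaklyRegular_of_ringKrullDim_quotient_eq rs hmem hd hq)

end EquationCount

/-! ## Route vocabulary: `Satₙ` at a TWO-DIMENSIONAL stage presented by `c` equations in a regular local ring of
dimension `2 + c` (appended) -/

section StageEquationCount

open IsLocalRing

variable {k K : Type u} [Field k] [Field K] [Algebra k K]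

/-- **`Satₙ` (`n ≥ 3`) at a two-dimensional stage presented by `c` equations in a regular local ring of dimension
`2 + c`.**  For a subalgebra stage `T ⊆ K` of Krull dimension `2` (a binder of `SaturationFourSurfaceResidual₄`) with a
ring isomorphism `e : ↥T ≃+* S ⧸ (rs)`, `S` regular local of dimension `2 + rs.length`, `rs ⊆ 𝔪_S`: the route's inline
sets satisfy `ca T ⊆ caAt n T` for every `n ≥ 3` — the regularity of `rs` is NOT an input any more (equation count,
`isWeaklyRegular_of_ringKrullDim_quotient_eq`; `dim S ⧸ (rs) = dim ↥T = 2` along `e`).  So the (NG) hypothesis of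
`…PersistenceSurfaceDoorNonGorenstein` is idle at every stage that is a complete intersection in the naive sense
«cut out by `codim` equations in a regular local ring». [cite: BrunsHerzog1998, Lemma 3.1.16, Cor. 2.1.4, Thm. 3.3.10; IyengarTakahashi2014, §2] -/
theorem ca_subset_caAt_of_ringEquiv_ofList_of_ringKrullDim (T : Subalgebra k K)
    (hT : ringKrullDim ↥T = (2 : ℕ)) {S : Type u} [CommRing S] [IsRegularLocalRing S] (rs : List S)
    (hmem : ∀ x ∈ rs, x ∈ maximalIdeal S) (hd : ringKrullDim S = (2 + rs.length : ℕ))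
    (e : ↥T ≃+* S ⧸ Ideal.ofList rs) {n : ℕ} (hn : 3 ≤ n) :
    {x : K | ∃ hx : x ∈ T, ∃ m : ℕ, ∀ i : ℕ, m ≤ i → ∀ (M N : ModuleCat.{u} ↥T),
        Module.Finite ↥T M → Module.Finite ↥T N →
          ∀ e : CategoryTheory.Abelian.Ext.{u} M N i, (⟨x, hx⟩ : ↥T) • e = 0} ⊆
      {x : K | ∃ hx : x ∈ T, ∀ i : ℕ, n ≤ i → ∀ (M N : ModuleCat.{u} ↥T),
        Module.Finite ↥T M → Module.Finite ↥T N →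
          ∀ e : CategoryTheory.Abelian.Ext.{u} M N i, (⟨x, hx⟩ : ↥T) • e = 0} := by
  have hq : ringKrullDim (S ⧸ Ideal.ofList rs) = (2 : ℕ) := by
    rw [← ringKrullDim_eq_of_ringEquiv e, hT]
  exact ca_subset_caAt_of_ringEquiv_ofList T rs hd
    (isWeaklyRegular_of_ringKrullDim_quotient_eq rs hmem hd hq) e hn

end StageEquationCount

end Summit.ResolutionOfSingularities.ResolutionOfSingularities.Theorems.HomologicalConductor.PersistenceSurfaceSaturationRegularSequenceExt

end
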